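import Summits.QuantumFields.YangMills.Theorems.PoincareLipschitzRegaugedTowerInductionMass
import Summits.QuantumFields.YangMills.Theorems.PoincareLipschitzAvgStabilitySmallData
import Summits.QuantumFields.YangMills.Theorems.PoincareLipschitzIteratedOfAvgStabilityStar
import HarnessLib

/-!
# Crux stmt-QuantumFields-19936 `UnitScaleTilt.HistoryTailL`, K2 at depth (route crux `PoincareLipschitz.BlockLipschitzL`, stmt-QuantumFields-23533),
# F6 of the K2 supplier plan of record (card v1.27 (c) ∕ v1.30 (c)), file F6-KNIT — h⋆ («AVERAGE STABILITY MODULO GAUGE» on good, box-orbit-minimising,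
# ℓ²-NEAR pairs) FROM THE PER-LEVEL WALK-MASS ROWS, and with it the registered stub `stub_iteratedLipschitz` modulo those rows — NO small-data guard

Cell `ym3-torus` (YM ladder rung R3 = continuum SU(2) Yang–Mills on the three-torus — a RUNG, NOT the Clay problem: not d = 4, not infinite volume,
not a mass gap); width seat `ym-ust-19936-w2` g11, F6 pen (LEAD `ym-ust-19936-w1` g7, 2026-08-29T02:02:59Z (4)).  Helper `--supports stmt-QuantumFields-19936`;
THEOREMS ONLY (0 `def`, 0 `sorry`).  Nothing here proves the walk-mass rows, h⋆, `stub_iteratedLipschitz`, `BlockLipschitzL`, `HistoryTailL` or a summit statement.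

WHAT IT DOES.  The F5 knit ✓`PoincareLipschitzAvgStabilitySmallData.avgStabilityModGauge_smallData_rows` (p686808) proves hStab's row for box-`ℓ²`-distance
`≤ (10⁷L⁶+1)⁻¹` because the F5 tower needs `144·C₁X ≤ 1`.  The F6 tower ✓`PoincareLipschitzRegaugedTowerInductionMass.exists_regauge_top_sum_normSq_le_of_massRows`
(this seat, over the LEAD's ✓p688053 and F2 ✓p683212) needs NO smallness of `X`: it needs, at every level `i < j`, a walk-mass bound `ms_i` for the
box-`ℓ²`-orbit-minimising gauge copies of `Ū^iU'` with `ℓ²(S_i)`-mass `≤ 2ρ^iX`, with `Σ_{i<j} ms_i` small.  THIS FILE packages that tower on the `K`-th torus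
of a `T3Family` in hStab⋆'s letters (✓`PoincareLipschitzAvgStabilityStar.stub_iteratedLipschitz_of_avgStability_star`, p683030): reading sets WITH A
SUPPLIER-CHOSEN EXTRA MARGIN `m : ℕ → ℕ` (monotone, `m_j ≤ L^{j+1}`), `S_i[m] = {b : tdist(b₋·Lⁱ, a₀·L^{j+1}) + 2L^{i+1} + m_i ≤ 8L^{j+1}}` (p685982's sets are
`m ≡ 0`; their level gap `2L(L−1)` would cap the supplier's mean-value boxes at `R ≲ 2L²`, so the gaps `m_{i+1} − m_i` are left to the supplier —
closure∕window∕footprint∕box letters in §1 over ✓`PoincareLipschitzTowerReadingSets`' legs), loop sizes `α_i := (5L)²/4·θBal(K−i)` from the windows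
(lit ✓`dist1_loopHol_le_local`), `Σ_{i<j}θBal(K−i) ≤ (10⁶L⁵+1)⁻¹` (✓`PoincareLipschitzThresholdSums`), ROW-L∕ROW-M by name (✓`PoincareLipschitzTrueLinBoxLocalRows`,
px7), `X := ‖pertVar U U'‖_{ℓ²(S_0)} ≤ √(box sum)`, `(2ρ^iX)² ≤ 4·L^{−i}·(box sum)`, `CS := 2√L` — and DISPLAYS exactly ONE hypothesis, the
WALK-MASS ROWS `hRows` in `T3Family` letters: for every `L` a nearness constant `T > 0` and, for all thresholds, a `γ₂ > 0` such that every good,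
box-orbit-minimising, `T`-near pair (hStab⋆'s binders VERBATIM) admits a margin schedule `m` and a walk-mass schedule `ms : ℕ → ℝ` with `0 ≤ ms_i ≤ 10⁻⁵`,
`Σ_{i<j} ms_i ≤ (10⁵L³)⁻¹`, and at every level `i < j`: every box-`ℓ²`-orbit-minimising (on `S_i[m]`, ✓`reTr_oneSite_le_of_orbitMin_level`'s `hmin` currency) gauge copy `(Ū^iU')^h` with
`Σ_{S_i}‖pertVar (Ū^iU) ((Ū^iU')^h)‖² ≤ 4L^{−i}·(box sum)` has two-block walk masses `5L·Σ_{N(c)}‖·‖ ≤ ms_i` at every `c ∈ S_{i+1}[m]`.  That row is the socket of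
the covariant mean-value road: ★w5 COV-BRIDGE ✓p688498 `normSq_le_of_cov_curl_div_plaq_torus` (frozen) with `κ` ⟸ COV-CURL-OF-RATIO, `δ` ⟸ COV-DIV-BRIDGE
(Kirchhoff at the minimiser, ✓p684680), `θ` ⟸ the windows, `S` ⟸ `2` (unitarity) or ALIGN + PHI-MV (★w3 g12) — pen F6-ROW.

WHAT IS PROVED (ns `…Theorems.PoincareLipschitzAvgStabilityOfMassRows`).
* §1 `four_inv_pow_mul_eq` (`(2·(√(L⁻³L²))^i·X)² = 4·(L^i)⁻¹·X²`), `thirty_cube_budget` (the guard arithmetic `30L³·520·(10⁵L³)⁻¹ ≤ 1/4`),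
  `readingSet_closed_margin` (closure of `S[m]` under two-block neighbourhoods for monotone `m`), `footprint_mem_readingSet_margin` (`m_j ≤ L^{j+1}`).
* §2 ★★★ `avgStability_star_of_massRows (hRows) : <h⋆ VERBATIM>` — hStab⋆'s row (`∀ L ∃ T ∃ CS …`) from the walk-mass rows, `T :=` the rows' `T`, `CS := 2√L`.
* §3 ★★★ `stub_iteratedLipschitz_of_massRows (hRows) : <stub_iteratedLipschitz VERBATIM>` (§2 ∘ ✓p683030).
(Decl-local `maxHeartbeats 400000` on §2, disclosed: the ~60-binder packaging elaborates above the 200k default, as p686808's did.)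
HONEST SCOPE.  Packaging; the rows are displayed, not proved; with the rows discharged in the small-data regime by Cauchy–Schwarz one recovers p686808.
The deep-regime supplier of the rows (single-scale covariant mean value closes them up to a depth wall ≈ 3K/4; the top quarter needs the Hodge form ∕
multiscale gauges — card v1.29 (c)) is NOT in this file.  YM₃ on T³ is rung R3, not the Clay problem; nothing of d = 4, the continuum or a mass gap.

References: T. Bałaban, CMP 98 (1985) 17–51 [Balaban1985Averaging] (Props 1–3, (11), (122)–(126) p.36, §3 (156)–(163)); CMP 109 (1987) 249–301
[Balaban1987RG1] ((0.1)–(0.4), (0.11), (0.14)); CMP 102 (1985) 255–275 [Balaban1985UV3] ((7) p.257).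
-/

noncomputable section

open scoped BigOperators Matrix.Norms.L2Operator
open NormedSpace

namespace Summit.QuantumFields.YangMills.Theorems.PoincareLipschitzAvgStabilityOfMassRows

open Literature.MathematicalPhysics.QuantumFieldTheory.Balaban1983to89
open Literature.MathematicalPhysics.QuantumFieldTheory.Balaban1983to89.T3ContinuumYM3Torus
open Literature.MathematicalPhysics.QuantumFieldTheory.Balaban1983to89.T3UnitScaleTilt (θBal)
open Finset T4Continuum BlockAveraging AveragingRT ExpMeanLog BlockAveragingEMLLinearised BlockAveragingEMLLinearisedBackground
open Summit.QuantumFields.YangMills.Theorems.PoincareLipschitzRegaugedTowerInductionMass (exists_regauge_top_sum_normSq_le_of_massRows)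
open Summit.QuantumFields.YangMills.Theorems.PoincareLipschitzTowerReadingSets (window_of_readingSet box_of_readingSet_zero
  tdist_corner_blockOf_le tdist_corner_shift_le tdist_corner_unshift_le tdist_self' tdist_corner_two_shifts_le)
open B3Taylor310LocalRemainder (tdist_triangle)
open Summit.QuantumFields.YangMills.Theorems.PoincareLipschitzRegaugeAbsorption (dist1_mul_inv_eq_norm_pertVar)
open Summit.QuantumFields.YangMills.Theorems.PoincareLipschitzThresholdSums (exists_gamma_forall_sum_θBal_le)
open BlockAveragingPlaquetteBoundLocal (dist1_loopHol_le_local)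
open T3MinimiserStabilityReduction (θBal_pos)
open Summit.QuantumFields.YangMills.Theorems.PoincareLipschitzTrueLinBoxLocalRows (sum_normSq_line_le_local sum_nbhd_le_local)
open Summit.QuantumFields.YangMills.Theorems.PoincareLipschitzAvgStabilitySmallData (geom_sum_le_five_halves rho_pow_mul_sqrt_eq C1_le kappa_div_rho_eq)
open Summit.QuantumFields.YangMills.Theorems.PoincareLipschitzAvgStabilityStar (stub_iteratedLipschitz_of_avgStability_star)

/-! ## §1 Numeric letters -/

/-- `(2·(√(L⁻³·L²))^i·X)² = 4·(L^i)⁻¹·X²` for `L > 0`: the tower's `ℓ²(S_i)` bound in the rows' currency. [folklore] -/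
theorem four_inv_pow_mul_eq {L : ℝ} (hL : 0 < L) (i : ℕ) (X : ℝ) :
    (2 * Real.sqrt ((L ^ 3)⁻¹ * L ^ 2) ^ i * X) ^ 2 = 4 * (L ^ i)⁻¹ * X ^ 2 := by
  have hρ : (L ^ 3)⁻¹ * L ^ 2 = L⁻¹ := by field_simp
  rw [hρ, mul_pow, mul_pow, ← pow_mul, mul_comm i 2, pow_mul, Real.sq_sqrt (inv_nonneg.2 hL.le), inv_pow]
  ring

/-- The walk-mass budget fits the tower's guard: `30L³·(520·(10⁵L³)⁻¹) ≤ 1/4` for `L > 0`. [folklore] -/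
theorem thirty_cube_budget {L : ℝ} (hL : 0 < L) : 30 * L ^ 3 * (520 * (1 / (10 ^ 5 * L ^ 3))) ≤ 1 / 4 := by
  have h3 : 0 < L ^ 3 := pow_pos hL 3
  rw [show 30 * L ^ 3 * (520 * (1 / (10 ^ 5 * L ^ 3))) = 30 * 520 / 10 ^ 5 * (L ^ 3 / L ^ 3) by ring, div_self h3.ne']
  norm_num


/-- ★ **CLOSURE WITH MARGINS**: for a margin schedule with `m i ≤ m (i+1)`, if the level-`(i+1)` site `y` has `D_{i+1}(y) + 2L^{i+2} + m(i+1) ≤ 8L^{j+1}`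
then every level-`i` site `x` whose block is `y − e_μ`, `y` or `y + e_μ` has `D_i(x) + 2L^{i+1} + m(i) ≤ 8L^{j+1}` (legs of ✓`readingSet_closed`:
one block `3(L−1)Lⁱ` + one step `L^{i+1}`, `6L^{i+1} ≤ 2L^{i+2}`). [folklore] -/
theorem readingSet_closed_margin (F : T3Family) (K : ℕ) {j i : ℕ} (hi : i + 1 ≤ F.m + K) (a₀ : Site (F.P K) (j + 1))
    {m : ℕ → ℕ} (hm : m i ≤ m (i + 1)) (y : Site (F.P K) (i + 1)) (μ : Fin (F.P K).d)
    (hy : Site.tdist (fun k => ((((y k).val * F.L ^ (i + 1) : ℕ)) : ZMod ((F.P K).sitesPerDir 0)))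
        (fun k => ((((a₀ k).val * F.L ^ (j + 1) : ℕ)) : ZMod ((F.P K).sitesPerDir 0))) + 2 * F.L ^ (i + 1 + 1) + m (i + 1) ≤ 8 * F.L ^ (j + 1))
    (x : Site (F.P K) i) (hx : blockOf x = y.unshift μ ∨ blockOf x = y ∨ blockOf x = y.shift μ) :
    Site.tdist (fun k => ((((x k).val * F.L ^ i : ℕ)) : ZMod ((F.P K).sitesPerDir 0)))
        (fun k => ((((a₀ k).val * F.L ^ (j + 1) : ℕ)) : ZMod ((F.P K).sitesPerDir 0))) + 2 * F.L ^ (i + 1) + m i ≤ 8 * F.L ^ (j + 1) := by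
  have hL3 : 3 ≤ F.L := (by obtain ⟨k, hk⟩ := F.hL.1; have := F.hL.2; omega)
  have h1 := tdist_corner_blockOf_le F K hi x
  have h2 : Site.tdist (fun k => (((((blockOf x) k).val * F.L ^ (i + 1) : ℕ)) : ZMod ((F.P K).sitesPerDir 0)))
      (fun k => ((((y k).val * F.L ^ (i + 1) : ℕ)) : ZMod ((F.P K).sitesPerDir 0))) ≤ F.L ^ (i + 1) := by
    rcases hx with h | h | h
    · rw [h]; exact tdist_corner_unshift_le F K hi y μ
    · rw [h, tdist_self']; exact Nat.zero_le _
    · rw [h]; exact tdist_corner_shift_le F K hi y μ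
  have h3 := tdist_triangle (fun k => ((((x k).val * F.L ^ i : ℕ)) : ZMod ((F.P K).sitesPerDir 0)))
    (fun k => (((((blockOf x) k).val * F.L ^ (i + 1) : ℕ)) : ZMod ((F.P K).sitesPerDir 0)))
    (fun k => ((((a₀ k).val * F.L ^ (j + 1) : ℕ)) : ZMod ((F.P K).sitesPerDir 0)))
  have h4 := tdist_triangle (fun k => (((((blockOf x) k).val * F.L ^ (i + 1) : ℕ)) : ZMod ((F.P K).sitesPerDir 0)))
    (fun k => ((((y k).val * F.L ^ (i + 1) : ℕ)) : ZMod ((F.P K).sitesPerDir 0)))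
    (fun k => ((((a₀ k).val * F.L ^ (j + 1) : ℕ)) : ZMod ((F.P K).sitesPerDir 0)))
  have h1' : Site.tdist (fun k => ((((x k).val * F.L ^ i : ℕ)) : ZMod ((F.P K).sitesPerDir 0)))
      (fun k => (((((blockOf x) k).val * F.L ^ (i + 1) : ℕ)) : ZMod ((F.P K).sitesPerDir 0))) ≤ 3 * F.L ^ (i + 1) := by
    refine h1.trans ?_
    calc 3 * (F.L - 1) * F.L ^ i ≤ 3 * F.L * F.L ^ i := Nat.mul_le_mul_right _ (Nat.mul_le_mul_left _ (Nat.sub_le _ _))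
      _ = 3 * F.L ^ (i + 1) := by rw [pow_succ]; ring
  have key : 6 * F.L ^ (i + 1) ≤ 2 * F.L ^ (i + 1 + 1) := by
    have hp : 0 < F.L ^ (i + 1) := pow_pos (by omega) _
    rw [show F.L ^ (i + 1 + 1) = F.L ^ (i + 1) * F.L by rw [pow_succ]]
    nlinarith
  omega

/-- ★ **FOOTPRINTS WITH MARGIN**: for each of the four bonds `c₀` of `∂a` and each level-`j` bond `b` with `blockOf b₋ ∈ {c₀₋, c₀₊}`,
`D_j(b₋) + 2L^{j+1} + m ≤ 8L^{j+1}` whenever `m ≤ L^{j+1}` (`D_j(b₋) ≤ 2L^{j+1} + 3(L−1)L^j`, legs of ✓`footprint_mem_readingSet`). [folklore] -/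
theorem footprint_mem_readingSet_margin (F : T3Family) (K : ℕ) {j : ℕ} (hj : j + 1 ≤ F.m + K) (a : Plaq (F.P K) (j + 1)) (c₀ : PBond (F.P K) (j + 1))
    (hc₀ : c₀ = ⟨a.src, a.μ⟩ ∨ c₀ = ⟨a.src.shift a.μ, a.ν⟩ ∨ c₀ = ⟨a.src.shift a.ν, a.μ⟩ ∨ c₀ = ⟨a.src, a.ν⟩)
    (b : PBond (F.P K) j) (hb : blockOf b.src = c₀.src ∨ blockOf b.src = c₀.tgt) {m : ℕ} (hm : m ≤ F.L ^ (j + 1)) :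
    Site.tdist (fun k => ((((b.src k).val * F.L ^ j : ℕ)) : ZMod ((F.P K).sitesPerDir 0)))
        (fun k => ((((a.src k).val * F.L ^ (j + 1) : ℕ)) : ZMod ((F.P K).sitesPerDir 0))) + 2 * F.L ^ (j + 1) + m ≤ 8 * F.L ^ (j + 1) := by
  have hL3 : 3 ≤ F.L := (by obtain ⟨k, hk⟩ := F.hL.1; have := F.hL.2; omega)
  have h1 := tdist_corner_blockOf_le F K hj b.src
  have hy : blockOf b.src = a.src ∨ (∃ μ, blockOf b.src = a.src.shift μ) ∨ (∃ μ ν, blockOf b.src = (a.src.shift μ).shift ν) := by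
    rcases hc₀ with rfl | rfl | rfl | rfl <;> rcases hb with h | h <;> simp only [PBond.tgt] at h
    · exact Or.inl h
    · exact Or.inr (Or.inl ⟨_, h⟩)
    · exact Or.inr (Or.inl ⟨_, h⟩)
    · exact Or.inr (Or.inr ⟨_, _, h⟩)
    · exact Or.inr (Or.inl ⟨_, h⟩)
    · exact Or.inr (Or.inr ⟨_, _, h⟩)
    · exact Or.inl h
    · exact Or.inr (Or.inl ⟨_, h⟩)
  have h2 := tdist_corner_two_shifts_le F K hj a.src (blockOf b.src) hy
  have h3 := tdist_triangle (fun k => ((((b.src k).val * F.L ^ j : ℕ)) : ZMod ((F.P K).sitesPerDir 0)))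
    (fun k => (((((blockOf b.src) k).val * F.L ^ (j + 1) : ℕ)) : ZMod ((F.P K).sitesPerDir 0)))
    (fun k => ((((a.src k).val * F.L ^ (j + 1) : ℕ)) : ZMod ((F.P K).sitesPerDir 0)))
  have e1 : F.L ^ (j + 1) = F.L * F.L ^ j := by rw [pow_succ]; ring
  have h4 : 3 * (F.L - 1) * F.L ^ j + 3 * F.L ^ j ≤ 3 * F.L ^ (j + 1) := by
    rw [e1]
    have : 3 * (F.L - 1) * F.L ^ j + 3 * F.L ^ j = 3 * ((F.L - 1) + 1) * F.L ^ j := by ring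
    rw [this, Nat.sub_add_cancel (by omega)]
    exact le_of_eq (by ring)
  have h5 : F.L ^ j ≥ 1 := Nat.one_le_pow _ _ (by omega)
  omega

/-! ## §2 h⋆ from the walk-mass rows -/

set_option maxHeartbeats 400000 in
/-- ★★★ **«AVERAGE STABILITY MODULO GAUGE» ON GOOD, BOX-ORBIT-MINIMISING, ℓ²-NEAR PAIRS — FROM THE PER-LEVEL WALK-MASS ROWS.**  If for every `L` there
are `T > 0` and, for all thresholds `(b₀, p₀)`, a `γ₂ > 0` such that every pair `(U, U')` of level-zero `SU(2)` fields on the `K`-th torus of a `T3Family`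
with `F.L = L` (`0 < γ ≤ γ₂`, `1 ≤ j`, `j + 3 ≤ K`, `a` a level-`(j+1)` plaquette) which is locally hierarchically good around `a`, box-`ℓ²`-orbit-minimising
and `ℓ²`-near (`√(box sum) ≤ T·√(L^{j+1})·θBal(K−j)`) — hStab⋆'s binders VERBATIM — admits a walk-mass schedule `ms` (`0 ≤ ms_i ≤ 10⁻⁵`,
`Σ_{i<j} ms_i ≤ (10⁵L³)⁻¹`) for which the WALK-MASS ROW holds at every level `i < j` on the reading sets `S_i`, then hStab⋆'s row holds: `∀ L ∃ T > 0 ∃ CS ≥ 0 …`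
(`T :=` the rows' `T`, `CS := 2√L`), i.e. SOME level-`j` gauge copy of `Ū^jU'` is within `CS/√(L^{j+1})·√(box sum)` of `Ū^jU` in `dist1` on the footprints of
`∂a`. [cite: Balaban1985Averaging, Props 1-3 (122)-(126) p.36, (156)-(163)] -/
theorem avgStability_star_of_massRows
    (hRows : open Literature.MathematicalPhysics.QuantumFieldTheory.Balaban1983to89 Literature.MathematicalPhysics.QuantumFieldTheory.Balaban1983to89.T3ContinuumYM3Torus in ∀ (L : ℕ), ∃ T : ℝ, 0 < T ∧ ∀ (b₀ p₀ : ℝ), 0 < b₀ → 2 < p₀ → ∃ γ₂ : ℝ, 0 < γ₂ ∧ ∀ (F : T3Family) (γ : ℝ), F.L = L → 0 < γ → γ ≤ γ₂ → ∀ (K j : ℕ), 1 ≤ j → j + 3 ≤ K → ∀ (a : Plaq (F.P K) (j + 1)) (U U' : GaugeField (F.P K) 0 (Matrix.specialUnitaryGroup (Fin 2) ℂ)), (∀ (i : ℕ) (q : Plaq (F.P K) i), i < j + 1 → Site.tdist (fun k => ((((q.src k).val * F.L ^ i : ℕ)) : ZMod ((F.P K).sitesPerDir 0))) (fun k => ((((a.src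 k).val * F.L ^ (j + 1) : ℕ)) : ZMod ((F.P K).sitesPerDir 0))) + 64 * F.L ^ i ≤ 64 * F.L ^ (j + 1) → GaugeGroup.dist1 (GaugeField.plaqHol (Averaging.iter (fun i' => BlockAveraging.blockAvg (P := F.P K) (j := i') T3UnitLawDensityEML.ℰp) i U) q) < T3UnitScaleTilt.θBal F.L γ b₀ p₀ (K - i)) → (∀ (i : ℕ) (q : Plaq (F.P K) i), i < j + 1 → Site.tdist (fun k => ((((q.src k).val * F.L ^ i : ℕ)) : ZMod ((F.P K).sitesPerDir 0))) (fun k => ((((a.src k).val * F.L ^ (j + 1) : ℕ)) : ZMod ((F.P K).sitesPerDir 0))) + 64 * F.L ^ i ≤ 64 * F.L ^ (j + 1) → GaugeGroup.dist1 (GaugeField.plaqHol (Averaging.iter (fun i' => BlockAveraging.blockAvg (P := F.P K) (j := i') T3UnitLawDensityEML.ℰp) i U') q) < T3UnitScaleTilt.θBal F.L γ b₀ p₀ (K - i)) → (∀ k : GaugeTransf (F.P K) 0 (Matrix.specialUnitaryGroup (Fin 2) ℂ), (∑ b : PBond (F.P K) 0, if (∀ k, (b.src k - ((((a.src k).val *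 F.L ^ (j + 1) : ℕ)) : ZMod ((F.P K).sitesPerDir 0)) + ((8 * F.L ^ (j + 1) : ℕ) : ZMod ((F.P K).sitesPerDir 0))).val < 17 * F.L ^ (j + 1)) ∧ (∀ k, (b.tgt k - ((((a.src k).val * F.L ^ (j + 1) : ℕ)) : ZMod ((F.P K).sitesPerDir 0)) + ((8 * F.L ^ (j + 1) : ℕ) : ZMod ((F.P K).sitesPerDir 0))).val < 17 * F.L ^ (j + 1)) then GaugeGroup.dist1 (U b * (U' b)⁻¹) ^ 2 else 0) ≤ (∑ b : PBond (F.P K) 0, if (∀ k, (b.src k - ((((a.src k).val * F.L ^ (j + 1) : ℕ)) : ZMod ((F.P K).sitesPerDir 0)) + ((8 * F.L ^ (j + 1) : ℕ) : ZMod ((F.P K).sitesPerDir 0))).val < 17 * F.L ^ (j + 1)) ∧ (∀ k, (b.tgt k - ((((a.src k).val * F.L ^ (j + 1) : ℕ)) : ZMod ((F.P K).sitesPerDir 0)) + ((8 * F.L ^ (j + 1) : ℕ) : ZMod ((F.P K).sitesPerDir 0))).val < 17 * F.L ^ (j + 1)) then GaugeGroup.dist1 (U b * (GaugeField.gaugeAct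 k U' b)⁻¹) ^ 2 else 0)) → Real.sqrt (∑ b : PBond (F.P K) 0, if (∀ k, (b.src k - ((((a.src k).val * F.L ^ (j + 1) : ℕ)) : ZMod ((F.P K).sitesPerDir 0)) + ((8 * F.L ^ (j + 1) : ℕ) : ZMod ((F.P K).sitesPerDir 0))).val < 17 * F.L ^ (j + 1)) ∧ (∀ k, (b.tgt k - ((((a.src k).val * F.L ^ (j + 1) : ℕ)) : ZMod ((F.P K).sitesPerDir 0)) + ((8 * F.L ^ (j + 1) : ℕ) : ZMod ((F.P K).sitesPerDir 0))).val < 17 * F.L ^ (j + 1)) then GaugeGroup.dist1 (U b * (U' b)⁻¹) ^ 2 else 0) ≤ T * Real.sqrt ((F.L : ℝ) ^ (j + 1)) * T3UnitScaleTilt.θBal F.L γ b₀ p₀ (K - j) → ∃ m : ℕ → ℕ, (∀ i, m i ≤ m (i + 1)) ∧ m j ≤ F.L ^ (j + 1) ∧ ∃ ms : ℕ → ℝ, (∀ i, i < j → 0 ≤ ms i ∧ ms i ≤ 1 / 10 ^ 5) ∧ (∑ i ∈ Finset.range j, ms i ≤ 1 / (10 ^ 5 * (L : ℝ) ^ 3))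 ∧ ∀ i, i < j → ∀ h : GaugeTransf (F.P K) i (Matrix.specialUnitaryGroup (Fin 2) ℂ), (∀ k' : GaugeTransf (F.P K) i (Matrix.specialUnitaryGroup (Fin 2) ℂ), (∑ b : PBond (F.P K) i, if b ∈ Finset.univ.filter (fun b : PBond (F.P K) i => Site.tdist (fun k => ((((b.src k).val * F.L ^ i : ℕ)) : ZMod ((F.P K).sitesPerDir 0))) (fun k => ((((a.src k).val * F.L ^ (j + 1) : ℕ)) : ZMod ((F.P K).sitesPerDir 0))) + 2 * F.L ^ (i + 1) + m i ≤ 8 * F.L ^ (j + 1)) then GaugeGroup.dist1 (Averaging.iter (fun i' => BlockAveraging.blockAvg (P := F.P K) (j := i') T3UnitLawDensityEML.ℰp) i U b * (GaugeField.gaugeAct h (Averaging.iter (fun i' => BlockAveraging.blockAvg (P := F.P K) (j := i') T3UnitLawDensityEML.ℰp) i U') b)⁻¹) ^ 2 else 0) ≤ ∑ b : PBond (F.P K) i, if b ∈ Finset.univ.filter (fun b : PBond (F.P K) i => Site.tdist (fun k => ((((b.src k).val * F.L ^ i : ℕ)) : ZMod ((F.P K).sitesPerDir 0))) (fun k =>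 ((((a.src k).val * F.L ^ (j + 1) : ℕ)) : ZMod ((F.P K).sitesPerDir 0))) + 2 * F.L ^ (i + 1) + m i ≤ 8 * F.L ^ (j + 1)) then GaugeGroup.dist1 (Averaging.iter (fun i' => BlockAveraging.blockAvg (P := F.P K) (j := i') T3UnitLawDensityEML.ℰp) i U b * (GaugeField.gaugeAct k' (GaugeField.gaugeAct h (Averaging.iter (fun i' => BlockAveraging.blockAvg (P := F.P K) (j := i') T3UnitLawDensityEML.ℰp) i U')) b)⁻¹) ^ 2 else 0) → ∑ b ∈ Finset.univ.filter (fun b : PBond (F.P K) i => Site.tdist (fun k => ((((b.src k).val * F.L ^ i : ℕ)) : ZMod ((F.P K).sitesPerDir 0))) (fun k => ((((a.src k).val * F.L ^ (j + 1) : ℕ)) : ZMod ((F.P K).sitesPerDir 0))) + 2 * F.L ^ (i + 1) + m i ≤ 8 * F.L ^ (j + 1)), ‖BlockAveragingEMLLinearisedBackground.pertVar (Averaging.iter (fun i' => BlockAveraging.blockAvg (P := F.P K) (j := i') T3UnitLawDensityEML.ℰp) i U) (GaugeField.gaugeAct h (Averaging.iter (fun i' => BlockAveraging.blockAvg (P :=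 F.P K) (j := i') T3UnitLawDensityEML.ℰp) i U')) b‖ ^ 2 ≤ 4 * ((F.L : ℝ) ^ i)⁻¹ * (∑ b : PBond (F.P K) 0, if (∀ k, (b.src k - ((((a.src k).val * F.L ^ (j + 1) : ℕ)) : ZMod ((F.P K).sitesPerDir 0)) + ((8 * F.L ^ (j + 1) : ℕ) : ZMod ((F.P K).sitesPerDir 0))).val < 17 * F.L ^ (j + 1)) ∧ (∀ k, (b.tgt k - ((((a.src k).val * F.L ^ (j + 1) : ℕ)) : ZMod ((F.P K).sitesPerDir 0)) + ((8 * F.L ^ (j + 1) : ℕ) : ZMod ((F.P K).sitesPerDir 0))).val < 17 * F.L ^ (j + 1)) then GaugeGroup.dist1 (U b * (U' b)⁻¹) ^ 2 else 0) → ∀ c ∈ Finset.univ.filter (fun b : PBond (F.P K) (i + 1) => Site.tdist (fun k => ((((b.src k).val * F.L ^ (i + 1) : ℕ)) : ZMod ((F.P K).sitesPerDir 0))) (fun k => ((((a.src k).val * F.L ^ (j + 1) : ℕ)) : ZMod ((F.P K).sitesPerDir 0))) + 2 * F.L ^ (i + 1 + 1) + m (i + 1) ≤ 8 * F.L ^ (j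 + 1)), ((((F.P K).d + 2) * (F.P K).L : ℕ) : ℝ) * ∑ b ∈ Finset.univ.filter (fun b : PBond (F.P K) i => blockOf b.src = c.src ∨ blockOf b.src = c.tgt), ‖BlockAveragingEMLLinearisedBackground.pertVar (Averaging.iter (fun i' => BlockAveraging.blockAvg (P := F.P K) (j := i') T3UnitLawDensityEML.ℰp) i U) (GaugeField.gaugeAct h (Averaging.iter (fun i' => BlockAveraging.blockAvg (P := F.P K) (j := i') T3UnitLawDensityEML.ℰp) i U')) b‖ ≤ ms i) :
    open Literature.MathematicalPhysics.QuantumFieldTheory.Balaban1983to89 Literature.MathematicalPhysics.QuantumFieldTheory.Balaban1983to89.T3ContinuumYM3Torus in ∀ (L : ℕ), ∃ T : ℝ, 0 < T ∧ ∃ CS : ℝ, 0 ≤ CS ∧ ∀ (b₀ p₀ : ℝ), 0 < b₀ → 2 < p₀ → ∃ γ₁ : ℝ, 0 < γ₁ ∧ γ₁ ≤ 1 ∧ ∀ (F : T3Family) (γ : ℝ), F.L = L → 0 < γ → γ ≤ γ₁ → ∀ (K j : ℕ), 1 ≤ j → j + 3 ≤ K → ∀ (a : Plaq (F.P K) (j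 + 1)) (U U' : GaugeField (F.P K) 0 (Matrix.specialUnitaryGroup (Fin 2) ℂ)), (∀ (i : ℕ) (q : Plaq (F.P K) i), i < j + 1 → Site.tdist (fun k => ((((q.src k).val * F.L ^ i : ℕ)) : ZMod ((F.P K).sitesPerDir 0))) (fun k => ((((a.src k).val * F.L ^ (j + 1) : ℕ)) : ZMod ((F.P K).sitesPerDir 0))) + 64 * F.L ^ i ≤ 64 * F.L ^ (j + 1) → GaugeGroup.dist1 (GaugeField.plaqHol (Averaging.iter (fun i' => BlockAveraging.blockAvg (P := F.P K) (j := i') T3UnitLawDensityEML.ℰp) i U) q) < T3UnitScaleTilt.θBal F.L γ b₀ p₀ (K - i)) → (∀ (i : ℕ) (q : Plaq (F.P K) i), i < j + 1 → Site.tdist (fun k => ((((q.src k).val * F.L ^ i : ℕ)) : ZMod ((F.P K).sitesPerDir 0))) (fun k => ((((a.src k).val * F.L ^ (j + 1) : ℕ)) : ZMod ((F.P K).sitesPerDir 0))) + 64 * F.L ^ i ≤ 64 * F.L ^ (j + 1) → GaugeGroup.dist1 (GaugeField.plaqHol (Averaging.iter (fun i' => BlockAveraging.blockAvg (P := F.P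 K) (j := i') T3UnitLawDensityEML.ℰp) i U') q) < T3UnitScaleTilt.θBal F.L γ b₀ p₀ (K - i)) → (∀ k : GaugeTransf (F.P K) 0 (Matrix.specialUnitaryGroup (Fin 2) ℂ), (∑ b : PBond (F.P K) 0, if (∀ k, (b.src k - ((((a.src k).val * F.L ^ (j + 1) : ℕ)) : ZMod ((F.P K).sitesPerDir 0)) + ((8 * F.L ^ (j + 1) : ℕ) : ZMod ((F.P K).sitesPerDir 0))).val < 17 * F.L ^ (j + 1)) ∧ (∀ k, (b.tgt k - ((((a.src k).val * F.L ^ (j + 1) : ℕ)) : ZMod ((F.P K).sitesPerDir 0)) + ((8 * F.L ^ (j + 1) : ℕ) : ZMod ((F.P K).sitesPerDir 0))).val < 17 * F.L ^ (j + 1)) then GaugeGroup.dist1 (U b * (U' b)⁻¹) ^ 2 else 0) ≤ (∑ b : PBond (F.P K) 0, if (∀ k, (b.src k - ((((a.src k).val * F.L ^ (j + 1) : ℕ)) : ZMod ((F.P K).sitesPerDir 0)) + ((8 * F.L ^ (j + 1) : ℕ) : ZMod ((F.P K).sitesPerDir 0))).val < 17 * F.L ^ (j + 1)) ∧ (∀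 k, (b.tgt k - ((((a.src k).val * F.L ^ (j + 1) : ℕ)) : ZMod ((F.P K).sitesPerDir 0)) + ((8 * F.L ^ (j + 1) : ℕ) : ZMod ((F.P K).sitesPerDir 0))).val < 17 * F.L ^ (j + 1)) then GaugeGroup.dist1 (U b * (GaugeField.gaugeAct k U' b)⁻¹) ^ 2 else 0)) → Real.sqrt (∑ b : PBond (F.P K) 0, if (∀ k, (b.src k - ((((a.src k).val * F.L ^ (j + 1) : ℕ)) : ZMod ((F.P K).sitesPerDir 0)) + ((8 * F.L ^ (j + 1) : ℕ) : ZMod ((F.P K).sitesPerDir 0))).val < 17 * F.L ^ (j + 1)) ∧ (∀ k, (b.tgt k - ((((a.src k).val * F.L ^ (j + 1) : ℕ)) : ZMod ((F.P K).sitesPerDir 0)) + ((8 * F.L ^ (j + 1) : ℕ) : ZMod ((F.P K).sitesPerDir 0))).val < 17 * F.L ^ (j + 1)) then GaugeGroup.dist1 (U b * (U' b)⁻¹) ^ 2 else 0) ≤ T * Real.sqrt ((F.L : ℝ) ^ (j + 1)) * T3UnitScaleTilt.θBal F.L γ b₀ p₀ (K - j) → ∃ h : GaugeTransf (F.P K)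 j (Matrix.specialUnitaryGroup (Fin 2) ℂ), ∀ c : PBond (F.P K) (j + 1), (c = ⟨a.src, a.μ⟩ ∨ c = ⟨a.src.shift a.μ, a.ν⟩ ∨ c = ⟨a.src.shift a.ν, a.μ⟩ ∨ c = ⟨a.src, a.ν⟩) → ∀ b : PBond (F.P K) j, (blockOf b.src = c.src ∨ blockOf b.src = c.tgt) → (blockOf b.tgt = c.src ∨ blockOf b.tgt = c.tgt) → GaugeGroup.dist1 (Averaging.iter (fun i' => BlockAveraging.blockAvg (P := F.P K) (j := i') T3UnitLawDensityEML.ℰp) j U b * (GaugeField.gaugeAct h (Averaging.iter (fun i' => BlockAveraging.blockAvg (P := F.P K) (j := i') T3UnitLawDensityEML.ℰp) j U') b)⁻¹) ≤ CS / Real.sqrt ((F.L : ℝ) ^ (j + 1)) * Real.sqrt (∑ b : PBond (F.P K) 0, if (∀ k, (b.src k - ((((a.src k).val * F.L ^ (j + 1) : ℕ)) : ZMod ((F.P K).sitesPerDir 0)) + ((8 * F.L ^ (j + 1) : ℕ) : ZMod ((F.P K).sitesPerDir 0))).val < 17 * F.L ^ (j + 1)) ∧ (∀ k, (b.tgt k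 - ((((a.src k).val * F.L ^ (j + 1) : ℕ)) : ZMod ((F.P K).sitesPerDir 0)) + ((8 * F.L ^ (j + 1) : ℕ) : ZMod ((F.P K).sitesPerDir 0))).val < 17 * F.L ^ (j + 1)) then GaugeGroup.dist1 (U b * (U' b)⁻¹) ^ 2 else 0) := by
  intro L
  obtain ⟨T, hT, HR⟩ := hRows L
  refine ⟨T, hT, 2 * Real.sqrt L, by positivity, ?_⟩
  intro b₀ p₀ hb hp
  obtain ⟨γ₂, hγ₂, HR'⟩ := HR b₀ p₀ hb hp
  obtain ⟨γt, hγt, hγt1, hθsum⟩ := exists_gamma_forall_sum_θBal_le hb (by linarith : (0 : ℝ) < p₀)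
    (σ := 1 / (10 ^ 6 * (L : ℝ) ^ 5 + 1)) (by positivity)
  refine ⟨min γ₂ γt, lt_min hγ₂ hγt, (min_le_right _ _).trans hγt1, ?_⟩
  intro F γ hFL hγ hγle K j hj1 hjK a U U' hU hU' hmin0 hnear
  obtain ⟨m, hmono, hmj, ms, hmsB, hmsS, hMassR⟩ := HR' F γ hFL hγ (hγle.trans (min_le_left _ _)) K j hj1 hjK a U U' hU hU' hmin0 hnear
  have hγt' : γ ≤ γt := hγle.trans (min_le_right _ _)
  subst hFL
  obtain ⟨Bx, hBx⟩ : ∃ Bx : ℝ, Bx = ∑ b : PBond (F.P K) 0, if (∀ k, (b.src k - ((((a.src k).val * F.L ^ (j + 1) : ℕ)) : ZMod ((F.P K).sitesPerDir 0)) + ((8 * F.L ^ (j + 1) : ℕ) : ZMod ((F.P K).sitesPerDir 0))).val < 17 * F.L ^ (j + 1)) ∧ (∀ k, (b.tgt k - ((((a.src k).val * F.L ^ (j + 1) : ℕ)) : ZMod ((F.P K).sitesPerDir 0)) + ((8 * F.L ^ (j + 1) : ℕ) : ZMod ((F.P K).sitesPerDir 0))).val < 17 * F.L ^ (j + 1))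 then GaugeGroup.dist1 (U b * (U' b)⁻¹) ^ 2 else 0 := ⟨_, rfl⟩
  rw [← hBx] at hMassR ⊢
  have hL3 : 3 ≤ F.L := (by obtain ⟨k, hk⟩ := F.hL.1; have := F.hL.2; omega)
  have hLr : (3 : ℝ) ≤ (F.L : ℝ) := by exact_mod_cast hL3
  have hL1r : (1 : ℝ) ≤ (F.L : ℝ) := by linarith
  have hLpos : (0 : ℝ) < (F.L : ℝ) := by linarith
  have hd : (F.P K).d = 3 := rfl
  have hPL : (F.P K).L = F.L := rfl
  have hm := F.hm
  -- the reading sets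
  obtain ⟨S, hSdef⟩ : ∃ S : (i : ℕ) → Finset (PBond (F.P K) i), S = fun i => univ.filter (fun b : PBond (F.P K) i =>
    Site.tdist (fun k => ((((b.src k).val * F.L ^ i : ℕ)) : ZMod ((F.P K).sitesPerDir 0)))
        (fun k => ((((a.src k).val * F.L ^ (j + 1) : ℕ)) : ZMod ((F.P K).sitesPerDir 0))) + 2 * F.L ^ (i + 1) + m i ≤ 8 * F.L ^ (j + 1)) := ⟨_, rfl⟩
  have hmemS : ∀ i (b : PBond (F.P K) i), b ∈ S i ↔
      Site.tdist (fun k => ((((b.src k).val * F.L ^ i : ℕ)) : ZMod ((F.P K).sitesPerDir 0)))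
        (fun k => ((((a.src k).val * F.L ^ (j + 1) : ℕ)) : ZMod ((F.P K).sitesPerDir 0))) + 2 * F.L ^ (i + 1) + m i ≤ 8 * F.L ^ (j + 1) := by
    intro i b; rw [hSdef]; simp only [Finset.mem_filter, Finset.mem_univ, true_and]
  -- the unmargined reading (p685982's sets contain `S_i[m]`)
  have hmemS0 : ∀ i (b : PBond (F.P K) i), b ∈ S i →
      Site.tdist (fun k => ((((b.src k).val * F.L ^ i : ℕ)) : ZMod ((F.P K).sitesPerDir 0)))
        (fun k => ((((a.src k).val * F.L ^ (j + 1) : ℕ)) : ZMod ((F.P K).sitesPerDir 0))) + 2 * F.L ^ (i + 1) ≤ 8 * F.L ^ (j + 1) := by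
    intro i b hb; rw [hmemS] at hb; omega
  have hS : ∀ i, i < j → ∀ c ∈ S (i + 1), ∀ b : PBond (F.P K) i, (blockOf b.src = c.src ∨ blockOf b.src = c.tgt) → b ∈ S i := by
    intro i hi c hc b hb
    rw [hmemS] at hc ⊢
    refine readingSet_closed_margin F K (by omega) a.src (hmono i) c.src c.dir hc b.src ?_
    rcases hb with h | h
    · exact Or.inr (Or.inl h)
    · exact Or.inr (Or.inr h)
  -- the loop sizes from the windows
  obtain ⟨α, hαdef⟩ : ∃ α : ℕ → ℝ, α = fun i => (((((F.P K).d + 2) * (F.P K).L : ℕ) : ℝ)) ^ 2 / 4 * θBal F.L γ b₀ p₀ (K - i) := ⟨_, rfl⟩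
  have hθ0 : ∀ i, 0 ≤ θBal F.L γ b₀ p₀ (K - i) := fun i => (θBal_pos (by omega) hγ (hγt'.trans hγt1) hb p₀ _).le
  have hα0 : ∀ i, i < j → 0 ≤ α i := fun i _ => by rw [hαdef]; exact mul_nonneg (by positivity) (hθ0 i)
  have hα : ∀ i, i < j → ∀ c ∈ S (i + 1), ∀ idx : Idx (F.P K),
      dist1 (loopHol (Averaging.iter (fun i' => BlockAveraging.blockAvg (P := F.P K) (j := i') (expMeanLogSU (n := Fin 2))) i U) c idx) ≤ α i := by
    intro i hi c hc idx
    rw [hmemS] at hc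
    rw [hαdef]
    refine dist1_loopHol_le_local (hθ0 i) (by show i + 1 ≤ F.m + K; omega) c (fun q hq => ?_) idx
    have hq' : blockOf q.src = c.src.unshift c.dir ∨ blockOf q.src = c.src ∨ blockOf q.src = c.src.shift c.dir := hq
    have hcl := readingSet_closed_margin F K (by omega) a.src (hmono i) c.src c.dir hc q.src hq'
    have hwin := window_of_readingSet F K (show i ≤ j by omega) a.src q.src (by omega)
    exact hU i q (by omega) hwin
  have hθsum' : ∑ i ∈ Finset.range j, θBal F.L γ b₀ p₀ (K - i) ≤ 1 / (10 ^ 6 * (F.L : ℝ) ^ 5 + 1) := by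
    have hinj : Set.InjOn (fun i => K - i) ↑(Finset.range j) := by
      intro i₁ hi₁ i₂ hi₂ h
      have := Finset.mem_range.1 (Finset.mem_coe.1 hi₁); have := Finset.mem_range.1 (Finset.mem_coe.1 hi₂)
      simp only at h; omega
    rw [← Finset.sum_image hinj]
    exact hθsum F.L (by omega) γ hγ hγt' _
  have hθle : ∀ i, i < j → θBal F.L γ b₀ p₀ (K - i) ≤ 1 / (10 ^ 6 * (F.L : ℝ) ^ 5 + 1) := fun i hi =>
    (Finset.single_le_sum (f := fun i => θBal F.L γ b₀ p₀ (K - i)) (fun i _ => hθ0 i) (Finset.mem_range.2 hi)).trans hθsum'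
  -- the `ℓ²` datum (no smallness)
  obtain ⟨X, hXdef⟩ : ∃ X : ℝ, X = Real.sqrt (∑ b ∈ S 0, ‖pertVar U U' b‖ ^ 2) := ⟨_, rfl⟩
  have hX0 : 0 ≤ X := by rw [hXdef]; exact Real.sqrt_nonneg _
  have hXsq : ∑ b ∈ S 0, ‖pertVar U U' b‖ ^ 2 ≤ X ^ 2 := by rw [hXdef, Real.sq_sqrt (Finset.sum_nonneg fun _ _ => sq_nonneg _)]
  have hpert : ∀ b : PBond (F.P K) 0, ‖pertVar U U' b‖ = GaugeGroup.dist1 (U b * (U' b)⁻¹) := by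
    intro b
    rw [← dist1_mul_inv_eq_norm_pertVar U U' b, show U b * (U' b)⁻¹ = (U' b * (U b)⁻¹)⁻¹ by rw [mul_inv_rev, inv_inv], GaugeGroup.dist1_inv]
  have hBx0 : 0 ≤ Bx := by rw [hBx]; exact Finset.sum_nonneg fun b _ => by split_ifs <;> positivity
  have hXbox : ∑ b ∈ S 0, ‖pertVar U U' b‖ ^ 2 ≤ Bx := by
    rw [hBx]
    have hsub : S 0 ⊆ univ.filter (fun b : PBond (F.P K) 0 =>
        (∀ k, (b.src k - ((((a.src k).val * F.L ^ (j + 1) : ℕ)) : ZMod ((F.P K).sitesPerDir 0)) +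
            ((8 * F.L ^ (j + 1) : ℕ) : ZMod ((F.P K).sitesPerDir 0))).val < 17 * F.L ^ (j + 1)) ∧
          (∀ k, (b.tgt k - ((((a.src k).val * F.L ^ (j + 1) : ℕ)) : ZMod ((F.P K).sitesPerDir 0)) +
            ((8 * F.L ^ (j + 1) : ℕ) : ZMod ((F.P K).sitesPerDir 0))).val < 17 * F.L ^ (j + 1))) := by
      intro b hb
      exact Finset.mem_filter.2 ⟨Finset.mem_univ _, box_of_readingSet_zero F K a.src b (hmemS0 0 b hb)⟩
    rw [← Finset.sum_filter]
    calc ∑ b ∈ S 0, ‖pertVar U U' b‖ ^ 2 = ∑ b ∈ S 0, GaugeGroup.dist1 (U b * (U' b)⁻¹) ^ 2 :=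
          Finset.sum_congr rfl fun b _ => by rw [hpert]
      _ ≤ _ := Finset.sum_le_sum_of_subset_of_nonneg hsub fun _ _ _ => sq_nonneg _
  have hX2Bx : X ^ 2 ≤ Bx := by rw [hXdef, Real.sq_sqrt (Finset.sum_nonneg fun _ _ => sq_nonneg _)]; exact hXbox
  -- the tower's constants on the `K`-th torus
  have hκρ : (((((F.P K).d + 2) * (F.P K).L : ℕ) : ℝ)) * Real.sqrt (2 * (F.P K).d * ((F.P K).L : ℝ) ^ (F.P K).d * (2 * (F.P K).d)) / Real.sqrt ((((F.P K).L : ℝ) ^ (F.P K).d)⁻¹ * ((F.P K).L : ℝ) ^ 2)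
      = 30 * (F.L : ℝ) ^ 3 := by
    rw [hd, hPL]; push_cast; exact kappa_div_rho_eq hLpos
  have hρ1 : (((F.P K).L : ℝ) ^ (F.P K).d)⁻¹ * ((F.P K).L : ℝ) ^ 2 ≤ 1 := by
    rw [hd, hPL, inv_mul_le_iff₀ (by positivity)]
    nlinarith [pow_le_pow_right₀ hL1r (show 2 ≤ 3 by norm_num)]
  have h5 : (((((F.P K).d + 2) * (F.P K).L : ℕ) : ℝ)) = 5 * (F.L : ℝ) := by rw [hd, hPL]; push_cast; ring
  have hαi : ∀ i, α i = (5 * (F.L : ℝ)) ^ 2 / 4 * θBal F.L γ b₀ p₀ (K - i) := fun i => by simp only [hαdef, h5]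
  have hαle : ∀ i, i < j → α i ≤ 1 / 100000 := by
    intro i hi
    rw [hαi]
    have h1 : (5 * (F.L : ℝ)) ^ 2 / 4 * θBal F.L γ b₀ p₀ (K - i) ≤ (5 * (F.L : ℝ)) ^ 2 / 4 * (1 / (10 ^ 6 * (F.L : ℝ) ^ 5 + 1)) :=
      mul_le_mul_of_nonneg_left (hθle i hi) (by positivity)
    refine h1.trans ?_
    have hL5 : (F.L : ℝ) ^ 2 ≤ (F.L : ℝ) ^ 5 := pow_le_pow_right₀ hL1r (by norm_num)
    rw [mul_one_div, div_le_div_iff₀ (by positivity) (by norm_num)]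
    nlinarith
  have hα24 : ∀ i, i < j → α i ≤ 1 / 24 := fun i hi => (hαle i hi).trans (by norm_num)
  -- the displayed guards of the schedule
  have hms0 : ∀ i, i < j → 0 ≤ ms i := fun i hi => (hmsB i hi).1
  have hms72 : ∀ i, i < j → 72 * ms i ≤ 1 := fun i hi => by have := (hmsB i hi).2; linarith
  have hmsN : ∀ i, i < j → 3 * ms i + α i < deltaSU (Fin 2) := by
    intro i hi
    have := hαle i hi
    have := (hmsB i hi).2
    have hδ : (1 : ℝ) / 3 ≤ deltaSU (Fin 2) := by
      unfold deltaSU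
      rw [Fintype.card_fin]
      refine le_min le_rfl ?_
      have := Real.pi_gt_three
      push_cast
      linarith
    linarith
  have hsum : (((((F.P K).d + 2) * (F.P K).L : ℕ) : ℝ)) * Real.sqrt (2 * (F.P K).d * ((F.P K).L : ℝ) ^ (F.P K).d * (2 * (F.P K).d)) / Real.sqrt ((((F.P K).L : ℝ) ^ (F.P K).d)⁻¹ * ((F.P K).L : ℝ) ^ 2)
      * ∑ i ∈ Finset.range j, (159 * α i + 520 * ms i) ≤ 1 / 2 := by
    rw [hκρ]
    have hsplit : ∑ i ∈ Finset.range j, (159 * α i + 520 * ms i)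
        = 159 * ∑ i ∈ Finset.range j, α i + 520 * ∑ i ∈ Finset.range j, ms i := by
      rw [Finset.sum_add_distrib, Finset.mul_sum, Finset.mul_sum]
    rw [hsplit]
    have hSumA : ∑ i ∈ Finset.range j, α i ≤ (5 * (F.L : ℝ)) ^ 2 / 4 * (1 / (10 ^ 6 * (F.L : ℝ) ^ 5 + 1)) := by
      have : ∑ i ∈ Finset.range j, α i = (5 * (F.L : ℝ)) ^ 2 / 4 * ∑ i ∈ Finset.range j, θBal F.L γ b₀ p₀ (K - i) := by
        rw [Finset.mul_sum]; exact Finset.sum_congr rfl fun i _ => hαi i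
      rw [this]
      exact mul_le_mul_of_nonneg_left hθsum' (by positivity)
    have hL30 : (0 : ℝ) ≤ 30 * (F.L : ℝ) ^ 3 := by positivity
    have hkey1 : 30 * (F.L : ℝ) ^ 3 * (159 * ((5 * (F.L : ℝ)) ^ 2 / 4 * (1 / (10 ^ 6 * (F.L : ℝ) ^ 5 + 1)))) ≤ 1 / 4 := by
      rw [show 30 * (F.L : ℝ) ^ 3 * (159 * ((5 * (F.L : ℝ)) ^ 2 / 4 * (1 / (10 ^ 6 * (F.L : ℝ) ^ 5 + 1))))
          = (30 * 159 * 25 / 4) * (F.L : ℝ) ^ 5 / (10 ^ 6 * (F.L : ℝ) ^ 5 + 1) by ring]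
      rw [div_le_div_iff₀ (by positivity) (by norm_num)]
      nlinarith [pow_nonneg hLpos.le 5]
    have hkey2 : 30 * (F.L : ℝ) ^ 3 * (520 * ∑ i ∈ Finset.range j, ms i) ≤ 1 / 4 := by
      have h1 : 30 * (F.L : ℝ) ^ 3 * (520 * ∑ i ∈ Finset.range j, ms i) ≤ 30 * (F.L : ℝ) ^ 3 * (520 * (1 / (10 ^ 5 * (F.L : ℝ) ^ 3))) :=
        mul_le_mul_of_nonneg_left (mul_le_mul_of_nonneg_left hmsS (by norm_num)) hL30
      exact h1.trans (thirty_cube_budget hLpos)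
    have hα25 : 159 * ∑ i ∈ Finset.range j, α i ≤ 159 * ((5 * (F.L : ℝ)) ^ 2 / 4 * (1 / (10 ^ 6 * (F.L : ℝ) ^ 5 + 1))) :=
      mul_le_mul_of_nonneg_left hSumA (by norm_num)
    nlinarith [mul_le_mul_of_nonneg_left hα25 hL30]
  -- ROW-L ∕ ROW-M by name (px7)
  have hRowL' : ∀ i, i < j → ∀ (V W : GaugeField (F.P K) i (Matrix.specialUnitaryGroup (Fin 2) ℂ)),
      ∑ c ∈ S (i + 1), ‖((Fintype.card (Idx (F.P K)) : ℂ))⁻¹ • ∑ idx : Idx (F.P K),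
        ((holAt V (walk (emb c.src) (stairWord idx.2.1 (off idx.1))) : Matrix.specialUnitaryGroup (Fin 2) ℂ) : Matrix (Fin 2) (Fin 2) ℂ) *
          covWalkSum V (pertVar V W) (walk (walkEnd (emb c.src) (stairWord idx.2.1 (off idx.1))) (List.replicate (F.P K).L (c.dir, true))) *
        star ((holAt V (walk (emb c.src) (stairWord idx.2.1 (off idx.1))) : Matrix.specialUnitaryGroup (Fin 2) ℂ) : Matrix (Fin 2) (Fin 2) ℂ)‖ ^ 2
      ≤ (((F.P K).L : ℝ) ^ (F.P K).d)⁻¹ * ((F.P K).L : ℝ) ^ 2 * ∑ b ∈ S i, ‖pertVar V W b‖ ^ 2 :=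
    fun i hi V W => sum_normSq_line_le_local (by show i + 1 ≤ F.m + K; omega) V (pertVar V W) (S (i + 1)) (S i) (hS i hi)
  have hRowM' : ∀ i, i < j → ∀ g : PBond (F.P K) i → ℝ, (∀ b, 0 ≤ g b) →
      ∑ c ∈ S (i + 1), ∑ b ∈ univ.filter (fun b : PBond (F.P K) i => blockOf b.src = c.src ∨ blockOf b.src = c.tgt), g b ≤ 2 * (F.P K).d * ∑ b ∈ S i, g b :=
    fun i hi g hg => sum_nbhd_le_local (S (i + 1)) (S i) (hS i hi) g hg
  -- the displayed walk-mass rows, read in the tower's letters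
  have hρsq : ∀ i : ℕ, (2 * Real.sqrt ((((F.P K).L : ℝ) ^ (F.P K).d)⁻¹ * ((F.P K).L : ℝ) ^ 2) ^ i * X) ^ 2 ≤ 4 * ((F.L : ℝ) ^ i)⁻¹ * Bx := by
    intro i
    rw [hd, hPL, four_inv_pow_mul_eq hLpos i X]
    exact mul_le_mul_of_nonneg_left hX2Bx (by positivity)
  have hMass' : ∀ i, i < j → ∀ h : GaugeTransf (F.P K) i (Matrix.specialUnitaryGroup (Fin 2) ℂ),
      (∀ k' : GaugeTransf (F.P K) i (Matrix.specialUnitaryGroup (Fin 2) ℂ),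
        (∑ b : PBond (F.P K) i, if b ∈ S i then
            dist1 (Averaging.iter (fun i' => blockAvg (P := F.P K) (j := i') (expMeanLogSU (n := Fin 2))) i U b *
              (GaugeField.gaugeAct h (Averaging.iter (fun i' => blockAvg (P := F.P K) (j := i') (expMeanLogSU (n := Fin 2))) i U') b)⁻¹) ^ 2
          else 0) ≤
          ∑ b : PBond (F.P K) i, if b ∈ S i then
            dist1 (Averaging.iter (fun i' => blockAvg (P := F.P K) (j := i') (expMeanLogSU (n := Fin 2))) i U b *
              (GaugeField.gaugeAct k' (GaugeField.gaugeAct h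
                (Averaging.iter (fun i' => blockAvg (P := F.P K) (j := i') (expMeanLogSU (n := Fin 2))) i U')) b)⁻¹) ^ 2
          else 0) →
      ∑ b ∈ S i, ‖pertVar (Averaging.iter (fun i' => blockAvg (P := F.P K) (j := i') (expMeanLogSU (n := Fin 2))) i U)
          (GaugeField.gaugeAct h (Averaging.iter (fun i' => blockAvg (P := F.P K) (j := i') (expMeanLogSU (n := Fin 2))) i U')) b‖ ^ 2 ≤
        (2 * Real.sqrt ((((F.P K).L : ℝ) ^ (F.P K).d)⁻¹ * ((F.P K).L : ℝ) ^ 2) ^ i * X) ^ 2 →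
      ∀ c ∈ S (i + 1), ((((F.P K).d + 2) * (F.P K).L : ℕ) : ℝ) *
        ∑ b ∈ univ.filter (fun b : PBond (F.P K) i => blockOf b.src = c.src ∨ blockOf b.src = c.tgt),
          ‖pertVar (Averaging.iter (fun i' => blockAvg (P := F.P K) (j := i') (expMeanLogSU (n := Fin 2))) i U)
            (GaugeField.gaugeAct h (Averaging.iter (fun i' => blockAvg (P := F.P K) (j := i') (expMeanLogSU (n := Fin 2))) i U')) b‖ ≤ ms i := by
    intro i hi h hmin hsq c hc
    have key := hMassR i hi h
    rw [hSdef] at hmin hsq hc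
    exact key hmin (hsq.trans (by simpa only [hSdef] using hρsq i)) c hc
  -- the tower
  obtain ⟨h, -, hh⟩ := exists_regauge_top_sum_normSq_le_of_massRows (P := F.P K) (k := j) (by show j ≤ F.m + K; omega) U U' S α hα0 hα24 hα
    hX0 hXsq hρ1 ms hms0 hms72 hmsN hsum hMass' hRowL' hRowM'
  -- the footprint reading (sup ≤ ℓ² at the top only)
  refine ⟨h, fun c₀ hc₀ b hb _ => ?_⟩
  have hbS : b ∈ S j := by rw [hmemS]; exact footprint_mem_readingSet_margin F K (by omega) a c₀ hc₀ b hb hmj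
  obtain ⟨V, hVdef⟩ : ∃ V, V = Averaging.iter (fun i' => BlockAveraging.blockAvg (P := F.P K) (j := i') (expMeanLogSU (n := Fin 2))) j U := ⟨_, rfl⟩
  obtain ⟨W, hWdef⟩ : ∃ W, W = GaugeField.gaugeAct h
    (Averaging.iter (fun i' => BlockAveraging.blockAvg (P := F.P K) (j := i') (expMeanLogSU (n := Fin 2))) j U') := ⟨_, rfl⟩
  rw [← hVdef, ← hWdef] at hh
  have hsingle : ‖pertVar V W b‖ ^ 2 ≤ (2 * Real.sqrt ((((F.P K).L : ℝ) ^ (F.P K).d)⁻¹ * ((F.P K).L : ℝ) ^ 2) ^ j * X) ^ 2 :=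
    (Finset.single_le_sum (f := fun b => ‖pertVar V W b‖ ^ 2) (fun _ _ => sq_nonneg _) hbS).trans hh
  have hnorm : ‖pertVar V W b‖ ≤ 2 * Real.sqrt ((((F.P K).L : ℝ) ^ (F.P K).d)⁻¹ * ((F.P K).L : ℝ) ^ 2) ^ j * X :=
    (pow_le_pow_iff_left₀ (norm_nonneg _) (by positivity) two_ne_zero).1 hsingle
  have hdist : GaugeGroup.dist1 (V b * (W b)⁻¹) = ‖pertVar V W b‖ := by
    rw [show V b * (W b)⁻¹ = (W b * (V b)⁻¹)⁻¹ by rw [mul_inv_rev, inv_inv], GaugeGroup.dist1_inv]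
    exact dist1_mul_inv_eq_norm_pertVar V W b
  have hgoal : GaugeGroup.dist1 (V b * (W b)⁻¹) ≤ 2 * Real.sqrt (F.L : ℝ) / Real.sqrt ((F.L : ℝ) ^ (j + 1)) * Real.sqrt Bx := by
    rw [hdist]
    refine hnorm.trans ?_
    have hXle : X ≤ Real.sqrt Bx := by rw [hXdef]; exact Real.sqrt_le_sqrt hXbox
    have hρj : Real.sqrt ((((F.P K).L : ℝ) ^ (F.P K).d)⁻¹ * ((F.P K).L : ℝ) ^ 2) ^ j = Real.sqrt (F.L : ℝ) / Real.sqrt ((F.L : ℝ) ^ (j + 1)) := by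
      rw [hd, hPL, eq_div_iff (Real.sqrt_pos.2 (by positivity)).ne']
      exact rho_pow_mul_sqrt_eq hLpos j
    rw [hρj]
    have h2 : 0 ≤ 2 * (Real.sqrt (F.L : ℝ) / Real.sqrt ((F.L : ℝ) ^ (j + 1))) := by positivity
    calc 2 * (Real.sqrt (F.L : ℝ) / Real.sqrt ((F.L : ℝ) ^ (j + 1))) * X
        ≤ 2 * (Real.sqrt (F.L : ℝ) / Real.sqrt ((F.L : ℝ) ^ (j + 1))) * _ := mul_le_mul_of_nonneg_left hXle h2
      _ = _ := by ring
  rw [hVdef, hWdef] at hgoal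
  exact hgoal

/-! ## §3 The registered stub from the walk-mass rows -/

/-- ★★★ **`stub_iteratedLipschitz` FROM THE WALK-MASS ROWS** (§2 ∘ the hStab⋆-door ✓`stub_iteratedLipschitz_of_avgStability_star`, p683030): the registered
`j ≥ 2` stub of line `poincare_lipschitz` holds VERBATIM once the per-level walk-mass rows are supplied — NO small-data guard, NO displayed ROW-L∕ROW-M.
[cite: Balaban1987RG1, (0.4) p.253; Balaban1985Averaging, Props 1-3 (122)-(126) p.36] -/
theorem stub_iteratedLipschitz_of_massRows
    (hRows : open Literature.MathematicalPhysics.QuantumFieldTheory.Balaban1983to89 Literature.MathematicalPhysics.QuantumFieldTheory.Balaban1983to89.T3ContinuumYM3Torus in ∀ (L : ℕ), ∃ T : ℝ, 0 < T ∧ ∀ (b₀ p₀ : ℝ), 0 < b₀ → 2 < p₀ → ∃ γ₂ : ℝ, 0 < γ₂ ∧ ∀ (F : T3Family) (γ : ℝ), F.L = L → 0 < γ → γ ≤ γ₂ → ∀ (K j : ℕ), 1 ≤ j → j + 3 ≤ K → ∀ (a : Plaq (F.P K) (j + 1)) (U U' : GaugeField (F.P K) 0 (Matrix.specialUnitaryGroup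 (Fin 2) ℂ)), (∀ (i : ℕ) (q : Plaq (F.P K) i), i < j + 1 → Site.tdist (fun k => ((((q.src k).val * F.L ^ i : ℕ)) : ZMod ((F.P K).sitesPerDir 0))) (fun k => ((((a.src k).val * F.L ^ (j + 1) : ℕ)) : ZMod ((F.P K).sitesPerDir 0))) + 64 * F.L ^ i ≤ 64 * F.L ^ (j + 1) → GaugeGroup.dist1 (GaugeField.plaqHol (Averaging.iter (fun i' => BlockAveraging.blockAvg (P := F.P K) (j := i') T3UnitLawDensityEML.ℰp) i U) q) < T3UnitScaleTilt.θBal F.L γ b₀ p₀ (K - i)) → (∀ (i : ℕ) (q : Plaq (F.P K) i), i < j + 1 → Site.tdist (fun k => ((((q.src k).val * F.L ^ i : ℕ)) : ZMod ((F.P K).sitesPerDir 0))) (fun k => ((((a.src k).val * F.L ^ (j + 1) : ℕ)) : ZMod ((F.P K).sitesPerDir 0))) + 64 * F.L ^ i ≤ 64 * F.L ^ (j + 1) → GaugeGroup.dist1 (GaugeField.plaqHol (Averaging.iter (fun i' => BlockAveraging.blockAvg (P := F.P K) (j := i') T3UnitLawDensityEML.ℰp) i U') q) < T3UnitScaleTilt.θBal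 F.L γ b₀ p₀ (K - i)) → (∀ k : GaugeTransf (F.P K) 0 (Matrix.specialUnitaryGroup (Fin 2) ℂ), (∑ b : PBond (F.P K) 0, if (∀ k, (b.src k - ((((a.src k).val * F.L ^ (j + 1) : ℕ)) : ZMod ((F.P K).sitesPerDir 0)) + ((8 * F.L ^ (j + 1) : ℕ) : ZMod ((F.P K).sitesPerDir 0))).val < 17 * F.L ^ (j + 1)) ∧ (∀ k, (b.tgt k - ((((a.src k).val * F.L ^ (j + 1) : ℕ)) : ZMod ((F.P K).sitesPerDir 0)) + ((8 * F.L ^ (j + 1) : ℕ) : ZMod ((F.P K).sitesPerDir 0))).val < 17 * F.L ^ (j + 1)) then GaugeGroup.dist1 (U b * (U' b)⁻¹) ^ 2 else 0) ≤ (∑ b : PBond (F.P K) 0, if (∀ k, (b.src k - ((((a.src k).val * F.L ^ (j + 1) : ℕ)) : ZMod ((F.P K).sitesPerDir 0)) + ((8 * F.L ^ (j + 1) : ℕ) : ZMod ((F.P K).sitesPerDir 0))).val < 17 * F.L ^ (j + 1)) ∧ (∀ k, (b.tgt k - ((((a.src k).val * F.L ^ (j + 1) : ℕ)) : ZMod ((F.P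 K).sitesPerDir 0)) + ((8 * F.L ^ (j + 1) : ℕ) : ZMod ((F.P K).sitesPerDir 0))).val < 17 * F.L ^ (j + 1)) then GaugeGroup.dist1 (U b * (GaugeField.gaugeAct k U' b)⁻¹) ^ 2 else 0)) → Real.sqrt (∑ b : PBond (F.P K) 0, if (∀ k, (b.src k - ((((a.src k).val * F.L ^ (j + 1) : ℕ)) : ZMod ((F.P K).sitesPerDir 0)) + ((8 * F.L ^ (j + 1) : ℕ) : ZMod ((F.P K).sitesPerDir 0))).val < 17 * F.L ^ (j + 1)) ∧ (∀ k, (b.tgt k - ((((a.src k).val * F.L ^ (j + 1) : ℕ)) : ZMod ((F.P K).sitesPerDir 0)) + ((8 * F.L ^ (j + 1) : ℕ) : ZMod ((F.P K).sitesPerDir 0))).val < 17 * F.L ^ (j + 1)) then GaugeGroup.dist1 (U b * (U' b)⁻¹) ^ 2 else 0) ≤ T * Real.sqrt ((F.L : ℝ) ^ (j + 1)) * T3UnitScaleTilt.θBal F.L γ b₀ p₀ (K - j) → ∃ m : ℕ → ℕ, (∀ i, m i ≤ m (i + 1)) ∧ m j ≤ F.L ^ (j + 1) ∧ ∃ ms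 : ℕ → ℝ, (∀ i, i < j → 0 ≤ ms i ∧ ms i ≤ 1 / 10 ^ 5) ∧ (∑ i ∈ Finset.range j, ms i ≤ 1 / (10 ^ 5 * (L : ℝ) ^ 3)) ∧ ∀ i, i < j → ∀ h : GaugeTransf (F.P K) i (Matrix.specialUnitaryGroup (Fin 2) ℂ), (∀ k' : GaugeTransf (F.P K) i (Matrix.specialUnitaryGroup (Fin 2) ℂ), (∑ b : PBond (F.P K) i, if b ∈ Finset.univ.filter (fun b : PBond (F.P K) i => Site.tdist (fun k => ((((b.src k).val * F.L ^ i : ℕ)) : ZMod ((F.P K).sitesPerDir 0))) (fun k => ((((a.src k).val * F.L ^ (j + 1) : ℕ)) : ZMod ((F.P K).sitesPerDir 0))) + 2 * F.L ^ (i + 1) + m i ≤ 8 * F.L ^ (j + 1)) then GaugeGroup.dist1 (Averaging.iter (fun i' => BlockAveraging.blockAvg (P := F.P K) (j := i') T3UnitLawDensityEML.ℰp) i U b * (GaugeField.gaugeAct h (Averaging.iter (fun i' => BlockAveraging.blockAvg (P := F.P K) (j := i') T3UnitLawDensityEML.ℰp) i U') b)⁻¹) ^ 2 else 0) ≤ ∑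 b : PBond (F.P K) i, if b ∈ Finset.univ.filter (fun b : PBond (F.P K) i => Site.tdist (fun k => ((((b.src k).val * F.L ^ i : ℕ)) : ZMod ((F.P K).sitesPerDir 0))) (fun k => ((((a.src k).val * F.L ^ (j + 1) : ℕ)) : ZMod ((F.P K).sitesPerDir 0))) + 2 * F.L ^ (i + 1) + m i ≤ 8 * F.L ^ (j + 1)) then GaugeGroup.dist1 (Averaging.iter (fun i' => BlockAveraging.blockAvg (P := F.P K) (j := i') T3UnitLawDensityEML.ℰp) i U b * (GaugeField.gaugeAct k' (GaugeField.gaugeAct h (Averaging.iter (fun i' => BlockAveraging.blockAvg (P := F.P K) (j := i') T3UnitLawDensityEML.ℰp) i U')) b)⁻¹) ^ 2 else 0) → ∑ b ∈ Finset.univ.filter (fun b : PBond (F.P K) i => Site.tdist (fun k => ((((b.src k).val * F.L ^ i : ℕ)) : ZMod ((F.P K).sitesPerDir 0))) (fun k => ((((a.src k).val * F.L ^ (j + 1) : ℕ)) : ZMod ((F.P K).sitesPerDir 0))) + 2 * F.L ^ (i + 1) + m i ≤ 8 * F.L ^ (j + 1)), ‖BlockAveragingEMLLinearisedBackground.pertVar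 (Averaging.iter (fun i' => BlockAveraging.blockAvg (P := F.P K) (j := i') T3UnitLawDensityEML.ℰp) i U) (GaugeField.gaugeAct h (Averaging.iter (fun i' => BlockAveraging.blockAvg (P := F.P K) (j := i') T3UnitLawDensityEML.ℰp) i U')) b‖ ^ 2 ≤ 4 * ((F.L : ℝ) ^ i)⁻¹ * (∑ b : PBond (F.P K) 0, if (∀ k, (b.src k - ((((a.src k).val * F.L ^ (j + 1) : ℕ)) : ZMod ((F.P K).sitesPerDir 0)) + ((8 * F.L ^ (j + 1) : ℕ) : ZMod ((F.P K).sitesPerDir 0))).val < 17 * F.L ^ (j + 1)) ∧ (∀ k, (b.tgt k - ((((a.src k).val * F.L ^ (j + 1) : ℕ)) : ZMod ((F.P K).sitesPerDir 0)) + ((8 * F.L ^ (j + 1) : ℕ) : ZMod ((F.P K).sitesPerDir 0))).val < 17 * F.L ^ (j + 1)) then GaugeGroup.dist1 (U b * (U' b)⁻¹) ^ 2 else 0) → ∀ c ∈ Finset.univ.filter (fun b : PBond (F.P K) (i + 1) => Site.tdist (fun k => ((((b.src k).val * F.L ^ (i + 1) : ℕ)) : ZMod ((F.P K).sitesPerDir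 0))) (fun k => ((((a.src k).val * F.L ^ (j + 1) : ℕ)) : ZMod ((F.P K).sitesPerDir 0))) + 2 * F.L ^ (i + 1 + 1) + m (i + 1) ≤ 8 * F.L ^ (j + 1)), ((((F.P K).d + 2) * (F.P K).L : ℕ) : ℝ) * ∑ b ∈ Finset.univ.filter (fun b : PBond (F.P K) i => blockOf b.src = c.src ∨ blockOf b.src = c.tgt), ‖BlockAveragingEMLLinearisedBackground.pertVar (Averaging.iter (fun i' => BlockAveraging.blockAvg (P := F.P K) (j := i') T3UnitLawDensityEML.ℰp) i U) (GaugeField.gaugeAct h (Averaging.iter (fun i' => BlockAveraging.blockAvg (P := F.P K) (j := i') T3UnitLawDensityEML.ℰp) i U')) b‖ ≤ ms i) :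
    open Literature.MathematicalPhysics.QuantumFieldTheory.Balaban1983to89 Literature.MathematicalPhysics.QuantumFieldTheory.Balaban1983to89.T3ContinuumYM3Torus in ∀ (L : ℕ), ∃ CL : ℝ, 0 ≤ CL ∧ ∀ (b₀ p₀ : ℝ), 0 < b₀ → 2 < p₀ → ∃ γ₁ : ℝ, 0 < γ₁ ∧ γ₁ ≤ 1 ∧ ∀ (F : T3Family) (γ : ℝ), F.L = L → 0 < γ → γ ≤ γ₁ → ∀ (K j : ℕ), 1 ≤ j → j + 2 ≤ K → 2 ≤ j → ∀ (a : Plaq (F.P K) j) (U U' : GaugeField (F.P K) 0 (Matrix.specialUnitaryGroup (Fin 2) ℂ)), (∀ (i : ℕ) (q : Plaq (F.P K) i), i < j → Site.tdist (fun k => ((((q.src k).val * F.L ^ i : ℕ)) : ZMod ((F.P K).sitesPerDir 0))) (fun k => ((((a.src k).val * F.L ^ j : ℕ)) : ZMod ((F.P K).sitesPerDir 0))) + 64 * F.L ^ i ≤ 64 * F.L ^ j → GaugeGroup.dist1 (GaugeField.plaqHol (Averaging.iter (fun i' => BlockAveraging.blockAvg (P := F.P K) (j := i') T3UnitLawDensityEML.ℰp)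 i U) q) < T3UnitScaleTilt.θBal F.L γ b₀ p₀ (K - i)) → (∀ (i : ℕ) (q : Plaq (F.P K) i), i < j → Site.tdist (fun k => ((((q.src k).val * F.L ^ i : ℕ)) : ZMod ((F.P K).sitesPerDir 0))) (fun k => ((((a.src k).val * F.L ^ j : ℕ)) : ZMod ((F.P K).sitesPerDir 0))) + 64 * F.L ^ i ≤ 64 * F.L ^ j → GaugeGroup.dist1 (GaugeField.plaqHol (Averaging.iter (fun i' => BlockAveraging.blockAvg (P := F.P K) (j := i') T3UnitLawDensityEML.ℰp) i U') q) < T3UnitScaleTilt.θBal F.L γ b₀ p₀ (K - i)) → |GaugeGroup.dist1 (GaugeField.plaqHol (Averaging.iter (fun i' => BlockAveraging.blockAvg (P := F.P K) (j := i') T3UnitLawDensityEML.ℰp) j U) a) - GaugeGroup.dist1 (GaugeField.plaqHol (Averaging.iter (fun i' => BlockAveraging.blockAvg (P := F.P K) (j := i') T3UnitLawDensityEML.ℰp) j U') a)| ≤ CL / Real.sqrt ((F.L : ℝ) ^ j) * Real.sqrt (∑ b : PBond (F.P K) 0, if (∀ k, (b.src k - ((((a.src k).val * F.L ^ j : ℕ))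 : ZMod ((F.P K).sitesPerDir 0)) + ((8 * F.L ^ j : ℕ) : ZMod ((F.P K).sitesPerDir 0))).val < 17 * F.L ^ j) ∧ (∀ k, (b.tgt k - ((((a.src k).val * F.L ^ j : ℕ)) : ZMod ((F.P K).sitesPerDir 0)) + ((8 * F.L ^ j : ℕ) : ZMod ((F.P K).sitesPerDir 0))).val < 17 * F.L ^ j) then GaugeGroup.dist1 (U b * (U' b)⁻¹) ^ 2 else 0) :=
  stub_iteratedLipschitz_of_avgStability_star (avgStability_star_of_massRows hRows)

end Summit.QuantumFields.YangMills.Theorems.PoincareLipschitzAvgStabilityOfMassRows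

end
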